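import Literature.AlgebraicTopology.SingularHomology.RelativeHomology
import Mathlib.Topology.Homotopy.Basic
import Mathlib.Topology.UnitInterval
import HarnessLib

/-!
# Homotopy invariance of relative singular homology: discharge of the named fact
`Literature.AlgebraicTopology.SingularHomology.relativeSingularHomology.map_eq_of_homotopic`

`Literature.AlgebraicTopology.SingularHomology.RelativeHomology` states as a **named fact**
(D-0014) `Literature.relativeSingularHomology.map_eq_of_homotopic R M`: if `F` is a homotopy from `f` to
`g` through maps of pairs `(X, A) → (Y, B)` (`F(t, a) ∈ B` for `a ∈ A`), then `f_* = g_*` on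
`Hₙ(X, A; M)` (A. Hatcher, *Algebraic Topology*, CUP 2002, Prop. 2.19 / Ex. 2.27: "via the prism
operator"). Here it is **proved**, for all spaces, pairs, coefficients and universes
(`map_eq_of_homotopic_holds`), without any chain-level work, by the classical reduction of the
relative homotopy axiom to the absolute one and exactness (cf. Eilenberg–Steenrod, *Foundations
of Algebraic Topology* (1952), §I.5; tom Dieck, *Algebraic Topology* (2008), §10.2):

* `f = F ∘ i₀` and `g = F ∘ i₁` as maps of pairs `(X, A) → (I × X, I × A) → (Y, B)` (with
  `I × A` the subset `Prod.snd ⁻¹' A`, `i₀ x = (0, x)`, `i₁ x = (1, x)`), so it suffices that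
  `(i₀)_* = (i₁)_*` on `Hₙ(X, A) → Hₙ(I × X, I × A)`;
* both are sections of `p_*`, `p : (I × X, I × A) → (X, A)` the projection, and **`p_*` is an
  isomorphism** (`isIso_map_snd`): by the five lemma on the long exact sequences of the two pairs
  (`HomologicalComplex.HomologySequence.isIso_homologyMap_τ₃`, as in
  `Literature.AlgebraicTopology.SingularHomology.isIso_restrictLocal_of_retract`), since `p : I × X → X` and `p| : I × A → A` are homotopy
  equivalences (inverse `x ↦ (0, x)`, homotopy `(s, (t, x)) ↦ (st, x)`) and absolute singular
  homology is homotopy invariant (Mathlib; `Literature.AlgebraicTopology.SingularHomology.singularHomology.map_eq_of_homotopic`);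
* hence `(i₀)_* = (p_*)⁻¹ = (i₁)_*` and `f_* = F_* (i₀)_* = F_* (i₁)_* = g_*`.

Everything is proved; there are no new definitions (the cylinder maps are Mathlib's
`ContinuousMap.prodMk (const _) id` and `ContinuousMap.snd`).

## References

* A. Hatcher, *Algebraic Topology*, CUP 2002, §2.1 Prop. 2.19, Thm. 2.16 (naturality and
  exactness), Ex. 2.27 [HatcherAT2002].
* T. tom Dieck, *Algebraic Topology*, EMS 2008, §10.2 (homotopy axiom for pairs) [folklore
  derivation; not cited in the statements].
-/

noncomputable section

open CategoryTheory Limits Set unitInterval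

universe u v

namespace Literature.AlgebraicTopology.SingularHomology

variable (R : Type v) [CommRing R] (M : Type v) [AddCommGroup M] [Module R M]
variable {X Y : Type u} [TopologicalSpace X] [TopologicalSpace Y]

namespace relativeSingularHomology

/-! ### The cylinder of a pair -/

/-- The inclusion `iₜ : X → I × X`, `x ↦ (t, x)`, sends `A` into the cylinder `I × A`. [folklore] -/
lemma mapsTo_prodMk_const (A : Set X) (t : I) :
    MapsTo ((ContinuousMap.const X t).prodMk (ContinuousMap.id X)) A (Prod.snd ⁻¹' A : Set (I × X)) :=
  fun _ hx => hx

/-- The projection `p : I × X → X` sends the cylinder `I × A` into `A`. [folklore] -/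
lemma mapsTo_snd (A : Set X) : MapsTo (ContinuousMap.snd : C(I × X, X)) (Prod.snd ⁻¹' A : Set (I × X)) A :=
  fun _ hx => hx

/-- `p_* : Hₙ(I × X; M) → Hₙ(X; M)` is an isomorphism: the projection is a homotopy equivalence,
with inverse `x ↦ (0, x)` and homotopy `(s, (t, x)) ↦ (st, x)` from `i₀ ∘ p` to the identity
(Hatcher 2002, Cor. 2.11). [folklore] -/
theorem isIso_singularHomology_map_snd (n : ℕ) :
    IsIso (singularHomology.map R M (ContinuousMap.snd : C(I × X, X)) n) := by
  let H : ContinuousMap.Homotopy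
      (((ContinuousMap.const X (0 : I)).prodMk (ContinuousMap.id X)).comp
        (ContinuousMap.snd : C(I × X, X)))
      (ContinuousMap.id (I × X)) :=
    { toFun := fun stx => (⟨stx.1.1 * stx.2.1.1, mul_mem stx.1.2 stx.2.1.2⟩, stx.2.2)
      continuous_toFun := by fun_prop
      map_zero_left := fun tx => by
        rcases tx with ⟨t, x⟩
        simp only [Set.Icc.coe_zero, zero_mul]
        rfl
      map_one_left := fun tx => by
        rcases tx with ⟨t, x⟩
        simp only [Set.Icc.coe_one, one_mul, ContinuousMap.id_apply] }
  refine ⟨⟨singularHomology.map R M ((ContinuousMap.const X (0 : I)).prodMk (ContinuousMap.id X)) n,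
    ?_, ?_⟩⟩
  · rw [← singularHomology.map_comp, singularHomology.map_eq_of_homotopic R M ⟨H⟩,
      singularHomology.map_id]
  · rw [← singularHomology.map_comp]
    exact singularHomology.map_id R M n

/-- `(p|)_* : Hₙ(I × A; M) → Hₙ(A; M)` is an isomorphism (the same contraction preserves the
cylinder of `A`). [folklore] -/
theorem isIso_singularHomology_map_snd_sub (A : Set X) (n : ℕ) :
    IsIso (singularHomology.map R M (subsetRestrict ContinuousMap.snd (mapsTo_snd A)) n) := by
  let i₀ : C(↥A, ↥(Prod.snd ⁻¹' A : Set (I × X))) :=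
    subsetRestrict ((ContinuousMap.const X (0 : I)).prodMk (ContinuousMap.id X))
      (mapsTo_prodMk_const A 0)
  let H : ContinuousMap.Homotopy (i₀.comp (subsetRestrict ContinuousMap.snd (mapsTo_snd A)))
      (ContinuousMap.id ↥(Prod.snd ⁻¹' A : Set (I × X))) :=
    { toFun := fun sa => ⟨(⟨sa.1.1 * sa.2.1.1.1, mul_mem sa.1.2 sa.2.1.1.2⟩, sa.2.1.2), sa.2.2⟩
      continuous_toFun := by fun_prop
      map_zero_left := fun a => by
        rcases a with ⟨⟨t, x⟩, hx⟩
        apply Subtype.ext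
        simp only [Set.Icc.coe_zero, zero_mul]
        rfl
      map_one_left := fun a => by
        rcases a with ⟨⟨t, x⟩, hx⟩
        apply Subtype.ext
        simp only [Set.Icc.coe_one, one_mul, ContinuousMap.id_apply] }
  refine ⟨⟨singularHomology.map R M i₀ n, ?_, ?_⟩⟩
  · rw [← singularHomology.map_comp, singularHomology.map_eq_of_homotopic R M ⟨H⟩,
      singularHomology.map_id]
  · rw [← singularHomology.map_comp]
    exact singularHomology.map_id R M n

/-- **`p_* : Hₙ(I × X, I × A; M) → Hₙ(X, A; M)` is an isomorphism** — the five lemma on the long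
exact sequences of the pairs `(I × X, I × A)` and `(X, A)` (Hatcher 2002, §2.1, naturality and
exactness, Thm. 2.16 ff.). [folklore] -/
theorem isIso_map_snd (A : Set X) (n : ℕ) :
    IsIso (map R M (ContinuousMap.snd : C(I × X, X)) (mapsTo_snd A) n) := by
  have hS₁ := relativeSingularChainComplex.shortExact_subsetι_π R M (I × X) (Prod.snd ⁻¹' A)
  have hS₂ := relativeSingularChainComplex.shortExact_subsetι_π R M X A
  let φ := relativeSingularChainComplex.shortComplexMap R M (ContinuousMap.snd : C(I × X, X))
    (mapsTo_snd A)
  have hτ₁ : ∀ k, IsIso (HomologicalComplex.homologyMap φ.τ₁ k) := fun k =>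
    isIso_singularHomology_map_snd_sub R M A k
  have hτ₂ : ∀ k, IsIso (HomologicalComplex.homologyMap φ.τ₂ k) := fun k =>
    isIso_singularHomology_map_snd R M (X := X) k
  change IsIso (HomologicalComplex.homologyMap φ.τ₃ n)
  haveI := hτ₁ n
  exact HomologicalComplex.HomologySequence.isIso_homologyMap_τ₃ φ hS₁ hS₂ n inferInstance
    (hτ₂ n) (fun j _ => hτ₁ j) (fun j _ => by haveI := hτ₂ j; infer_instance)

/-- **`(i₀)_* = (i₁)_*` on `Hₙ(X, A) → Hₙ(I × X, I × A)`** (indeed `(iₛ)_* = (iₜ)_*` for all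
`s, t ∈ I`): all are right inverse to the isomorphism `p_*`. [folklore] -/
theorem map_prodMk_const_eq (A : Set X) (s t : I) (n : ℕ) :
    map R M ((ContinuousMap.const X s).prodMk (ContinuousMap.id X)) (mapsTo_prodMk_const A s) n =
      map R M ((ContinuousMap.const X t).prodMk (ContinuousMap.id X)) (mapsTo_prodMk_const A t) n := by
  haveI := isIso_map_snd R M A n
  rw [← cancel_mono (map R M (ContinuousMap.snd : C(I × X, X)) (mapsTo_snd A) n), ← map_comp,
    ← map_comp]
  rfl

/-- **Discharge of the named fact `Literature.AlgebraicTopology.SingularHomology.relativeSingularHomology.map_eq_of_homotopic`** (Hatcher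
2002, Prop. 2.19 / Ex. 2.27): homotopic maps of pairs induce the same map on relative singular
homology, for every commutative ring `R`, `R`-module `M` and spaces `X`, `Y`. Proof:
`f = F ∘ i₀`, `g = F ∘ i₁` as maps of pairs through the cylinder `(I × X, I × A)`, and
`(i₀)_* = (i₁)_*` (`map_prodMk_const_eq`; equal underlying maps give equal induced maps by the
congruence lemma `map.congr_simp`). [cite: HatcherAT2002, Prop. 2.19] -/
theorem map_eq_of_homotopic_holds : map_eq_of_homotopic R M (X := X) (Y := Y) := by
  intro A B f g hf hg F hF n
  have hFm : MapsTo (F : C(I × X, Y)) (Prod.snd ⁻¹' A : Set (I × X)) B := fun tx htx => hF tx htx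
  have ef : f = (F : C(I × X, Y)).comp ((ContinuousMap.const X (0 : I)).prodMk (ContinuousMap.id X)) := by
    ext x; exact (F.map_zero_left x).symm
  have eg : g = (F : C(I × X, Y)).comp ((ContinuousMap.const X (1 : I)).prodMk (ContinuousMap.id X)) := by
    ext x; exact (F.map_one_left x).symm
  rw [map.congr_simp R M f _ ef hf n, map.congr_simp R M g _ eg hg n,
    map_comp R M _ (F : C(I × X, Y)) (mapsTo_prodMk_const A 0) hFm n,
    map_comp R M _ (F : C(I × X, Y)) (mapsTo_prodMk_const A 1) hFm n,
    map_prodMk_const_eq R M A 0 1 n]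

end relativeSingularHomology

end Literature.AlgebraicTopology.SingularHomology
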